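import Summits.NavierStokesRegularity.NavierStokesRegularity.Theorems.ExtremiserTransienceNearExtremalTransienceExtremiserLiouvilleDensityLeaf
import Summits.NavierStokesRegularity.NavierStokesRegularity.Theorems.ExtremiserTransienceNearExtremalTransienceExtremiserLiouvillePlateauLimits
import Summits.NavierStokesRegularity.NavierStokesRegularity.Theorems.ExtremiserTransienceKStarAttainedDensity
import HarnessLib

/-!
# Crux `ExtremiserTransience.NearExtremalTransience` (stmt-NavierStokesRegularity-21883), line `extremiser_liouville`,
# stub K1b — THE FIRST-VARIATION INTEGRALS ALONG THE SOLENOIDAL TRUNCATIONS CONVERGE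

`--supports stmt-NavierStokesRegularity-21883` (helper).  Author: prover seat `ns-el-k1b` (g2).

For a smooth field `V` with `‖DV‖ ≤ B`, `V ∈ L⁶`, `DV ∈ L²` (`D²V ∈ L²` for the last one) and its solenoidal truncations
`Ψ_R := solenoidalTruncation V R` (`Ψ_R → V` in `Ḣ¹ ∩ Ḣ²`, files `…Convergence`), the three linear integrals entering the
first variation of the sharp stretching functional converge (`ω := curl V`):

* `tendsto_truncation_stretchingVariation` : `∫ (⟪curl Ψ_R, DV ω⟫ + ⟪ω, DΨ_R ω⟫ + ⟪ω, DV curl Ψ_R⟫) → 3 ∫⟪ω, DV ω⟫`;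
* `tendsto_truncation_enstrophyVariation`  : `∫ ⟪ω, curl Ψ_R⟫ → ∫ ‖ω‖²`;
* `tendsto_truncation_palinstrophyVariation` : `∫ ∑ᵢ ⟪Dω eᵢ, D(curl Ψ_R) eᵢ⟫ → ∫ |Dω|²_F`.

WHAT THIS IS NOT: bookkeeping (Cauchy–Schwarz against `tendsto_integral_of_sq_dominated`); nothing here proves NS
regularity. [folklore]
-/

noncomputable section

open Set Filter Topology MeasureTheory Metric Function
open scoped ENNReal NNReal Topology InnerProductSpace RealInnerProductSpace ContDiff
open Literature.Analysis.FluidPDE Literature.Analysis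

namespace Summit.NavierStokesRegularity.NavierStokesRegularity.Theorems

-- the problem directory repeats the summit name (`NavierStokesRegularity/NavierStokesRegularity`)
set_option linter.dupNamespace false

namespace ExtremiserLiouville

open DepletionLadder.KStar

variable {V : EuclideanSpace ℝ (Fin 3) → EuclideanSpace ℝ (Fin 3)}

/-- `‖L (e i)‖ ≤ ‖L‖` for the standard basis. [folklore] -/
theorem norm_apply_basisFun_le (L : EuclideanSpace ℝ (Fin 3) →L[ℝ] EuclideanSpace ℝ (Fin 3)) (i : Fin 3) :
    ‖L (EuclideanSpace.basisFun (Fin 3) ℝ i)‖ ≤ ‖L‖ := by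
  refine (L.le_opNorm _).trans ?_
  rw [(EuclideanSpace.basisFun (Fin 3) ℝ).orthonormal.1 i, mul_one]

/-- `∑ᵢ ⟪L eᵢ, L eᵢ⟫ = |L|²_F`. [folklore] -/
theorem sum_inner_apply_basisFun_self (L : EuclideanSpace ℝ (Fin 3) →L[ℝ] EuclideanSpace ℝ (Fin 3)) :
    ∑ i, ⟪L (EuclideanSpace.basisFun (Fin 3) ℝ i), L (EuclideanSpace.basisFun (Fin 3) ℝ i)⟫ = frobeniusNormSq L := by
  rw [frobeniusNormSq_eq_sum (EuclideanSpace.basisFun (Fin 3) ℝ) L]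
  exact Finset.sum_congr rfl fun i _ => real_inner_self_eq_norm_sq _

/-- `|∑ᵢ ⟪L eᵢ, P eᵢ⟫| ≤ 3 ‖L‖ ‖P‖`. [folklore] -/
theorem abs_sum_inner_apply_basisFun_le (L P : EuclideanSpace ℝ (Fin 3) →L[ℝ] EuclideanSpace ℝ (Fin 3)) :
    |∑ i, ⟪L (EuclideanSpace.basisFun (Fin 3) ℝ i), P (EuclideanSpace.basisFun (Fin 3) ℝ i)⟫| ≤ 3 * ‖L‖ * ‖P‖ := by
  refine (Finset.abs_sum_le_sum_abs _ _).trans ?_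
  have h : ∀ i ∈ (Finset.univ : Finset (Fin 3)),
      |⟪L (EuclideanSpace.basisFun (Fin 3) ℝ i), P (EuclideanSpace.basisFun (Fin 3) ℝ i)⟫| ≤ ‖L‖ * ‖P‖ := fun i _ =>
    (abs_real_inner_le_norm _ _).trans
      (mul_le_mul (norm_apply_basisFun_le L i) (norm_apply_basisFun_le P i) (norm_nonneg _) (norm_nonneg _))
  refine (Finset.sum_le_sum h).trans (le_of_eq ?_)
  simp only [Finset.sum_const, Finset.card_univ, Fintype.card_fin, nsmul_eq_mul, Nat.cast_ofNat]
  ring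

/-- `|∑ᵢ ⟪L eᵢ, P eᵢ⟫ − ∑ᵢ ⟪L eᵢ, Q eᵢ⟫| ≤ 3 ‖L‖ ‖P − Q‖`. [folklore] -/
theorem abs_sum_inner_apply_basisFun_sub_le (L P Q : EuclideanSpace ℝ (Fin 3) →L[ℝ] EuclideanSpace ℝ (Fin 3)) :
    |(∑ i, ⟪L (EuclideanSpace.basisFun (Fin 3) ℝ i), P (EuclideanSpace.basisFun (Fin 3) ℝ i)⟫) -
      ∑ i, ⟪L (EuclideanSpace.basisFun (Fin 3) ℝ i), Q (EuclideanSpace.basisFun (Fin 3) ℝ i)⟫| ≤ 3 * ‖L‖ * ‖P - Q‖ := by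
  have h : ∀ i, ⟪L (EuclideanSpace.basisFun (Fin 3) ℝ i), P (EuclideanSpace.basisFun (Fin 3) ℝ i)⟫ -
      ⟪L (EuclideanSpace.basisFun (Fin 3) ℝ i), Q (EuclideanSpace.basisFun (Fin 3) ℝ i)⟫ =
      ⟪L (EuclideanSpace.basisFun (Fin 3) ℝ i), (P - Q) (EuclideanSpace.basisFun (Fin 3) ℝ i)⟫ := fun i => by
    rw [← inner_sub_right]; rfl
  rw [← Finset.sum_sub_distrib]
  simp_rw [h]
  exact abs_sum_inner_apply_basisFun_le L (P - Q)

/-- `∫ ‖curl V‖ₑ² < ∞` from `DV ∈ L²`. [folklore] -/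
theorem lintegral_enorm_curl_sq_lt_top (hD1 : ∫⁻ x, ‖iteratedFDeriv ℝ 1 V x‖ₑ ^ 2 < ⊤) :
    ∫⁻ x, ‖curl V x‖ₑ ^ 2 < ⊤ := by
  have hκ0 : 0 ≤ ‖curlCLM‖ := norm_nonneg curlCLM
  have hle : ∀ x, ‖curl V x‖ₑ ≤ ENNReal.ofReal ‖curlCLM‖ * ‖iteratedFDeriv ℝ 1 V x‖ₑ := by
    intro x
    have h := norm_curl_le V x
    rw [← norm_iteratedFDeriv_one] at h
    calc ‖curl V x‖ₑ = ENNReal.ofReal ‖curl V x‖ := (ofReal_norm _).symm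
      _ ≤ ENNReal.ofReal (‖curlCLM‖ * ‖iteratedFDeriv ℝ 1 V x‖) := ENNReal.ofReal_le_ofReal h
      _ = ENNReal.ofReal ‖curlCLM‖ * ‖iteratedFDeriv ℝ 1 V x‖ₑ := by rw [ENNReal.ofReal_mul hκ0, ofReal_norm]
  calc ∫⁻ x, ‖curl V x‖ₑ ^ 2 ≤ ∫⁻ x, (ENNReal.ofReal ‖curlCLM‖) ^ 2 * ‖iteratedFDeriv ℝ 1 V x‖ₑ ^ 2 :=
        lintegral_mono fun x => by rw [← mul_pow]; exact pow_le_pow_left' (hle x) 2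
    _ < ⊤ := by
        rw [lintegral_const_mul' _ _ (ENNReal.pow_ne_top ENNReal.ofReal_ne_top)]
        exact ENNReal.mul_lt_top (ENNReal.pow_lt_top ENNReal.ofReal_lt_top) hD1

/-- `∫ (ofReal ‖D(curl V)‖)² < ∞` from `D²V ∈ L²`. [folklore] -/
theorem lintegral_ofReal_norm_fderiv_curl_sq_lt_top (hV2 : ContDiff ℝ 2 V) (hD2 : ∫⁻ x, ‖iteratedFDeriv ℝ 2 V x‖ₑ ^ 2 < ⊤) :
    ∫⁻ x, ENNReal.ofReal ‖fderiv ℝ (curl V) x‖ ^ 2 < ⊤ := by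
  have hκ0 : 0 ≤ ‖curlCLM‖ := norm_nonneg curlCLM
  have hle : ∀ x, ENNReal.ofReal ‖fderiv ℝ (curl V) x‖ ≤ ENNReal.ofReal ‖curlCLM‖ * ‖iteratedFDeriv ℝ 2 V x‖ₑ := by
    intro x
    calc ENNReal.ofReal ‖fderiv ℝ (curl V) x‖ ≤ ENNReal.ofReal (‖curlCLM‖ * ‖iteratedFDeriv ℝ 2 V x‖) :=
          ENNReal.ofReal_le_ofReal (norm_fderiv_curl_le hV2 x)
      _ = ENNReal.ofReal ‖curlCLM‖ * ‖iteratedFDeriv ℝ 2 V x‖ₑ := by rw [ENNReal.ofReal_mul hκ0, ofReal_norm]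
  calc ∫⁻ x, ENNReal.ofReal ‖fderiv ℝ (curl V) x‖ ^ 2 ≤ ∫⁻ x, (ENNReal.ofReal ‖curlCLM‖) ^ 2 * ‖iteratedFDeriv ℝ 2 V x‖ₑ ^ 2 :=
        lintegral_mono fun x => by rw [← mul_pow]; exact pow_le_pow_left' (hle x) 2
    _ < ⊤ := by
        rw [lintegral_const_mul' _ _ (ENNReal.pow_ne_top ENNReal.ofReal_ne_top)]
        exact ENNReal.mul_lt_top (ENNReal.pow_lt_top ENNReal.ofReal_lt_top) hD2

/-- **Stretching variation along the truncations**: `∫ (⟪curl Ψ_R, DV ω⟫ + ⟪ω, DΨ_R ω⟫ + ⟪ω, DV curl Ψ_R⟫) → 3 S(V)`.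
[folklore] -/
theorem tendsto_truncation_stretchingVariation (hV : ContDiff ℝ (⊤ : ℕ∞) V) {B : ℝ} (hB : ∀ x, ‖fderiv ℝ V x‖ ≤ B)
    (hV6 : ∫⁻ x, ‖V x‖ₑ ^ 6 < ⊤) (hD1 : ∫⁻ x, ‖iteratedFDeriv ℝ 1 V x‖ₑ ^ 2 < ⊤) :
    Tendsto (fun R : ℝ => ∫ x, (⟪curl (solenoidalTruncation V R) x, fderiv ℝ V x (curl V x)⟫ +
        ⟪curl V x, fderiv ℝ (solenoidalTruncation V R) x (curl V x)⟫ +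
        ⟪curl V x, fderiv ℝ V x (curl (solenoidalTruncation V R) x)⟫)) atTop
      (𝓝 (3 * ∫ x, ⟪curl V x, fderiv ℝ V x (curl V x)⟫)) := by
  -- keep the truncation OPAQUE
  obtain ⟨Ψ, hΨdef⟩ : ∃ Ψ : ℝ → EuclideanSpace ℝ (Fin 3) → EuclideanSpace ℝ (Fin 3), Ψ = fun R => solenoidalTruncation V R :=
    ⟨_, rfl⟩
  have hΨR : ∀ R, solenoidalTruncation V R = Ψ R := fun R => by rw [hΨdef]
  simp only [hΨR]
  have hB0 : 0 ≤ B := (norm_nonneg _).trans (hB 0)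
  set κ : ℝ := ‖curlCLM‖ with hκ
  have hκ0 : 0 ≤ κ := norm_nonneg curlCLM
  have hV1 : ContDiff ℝ 1 V := contDiff_infty.1 hV 1
  have hωB : ∀ x, ‖curl V x‖ ≤ κ * B := fun x => (norm_curl_le V x).trans (by gcongr; exact hB x)
  have hZ := lintegral_enorm_curl_sq_lt_top hD1
  have hωc : Continuous (curl V) := (contDiff_curl_top hV).continuous
  have hDVc : Continuous (fderiv ℝ V) := hV.continuous_fderiv (by simp)
  have hΨs : ∀ R, ContDiff ℝ ∞ (Ψ R) := by rw [hΨdef]; exact fun R => contDiff_solenoidalTruncation hV R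
  have hΨ1 : ∀ R, ContDiff ℝ 1 (Ψ R) := fun R => contDiff_infty.1 (hΨs R) 1
  have hΨc : ∀ R, 0 < R → HasCompactSupport (Ψ R) := by
    rw [hΨdef]; exact fun R hR => hasCompactSupport_solenoidalTruncation hR
  have hcΨc : ∀ R, Continuous (curl (Ψ R)) := fun R => (contDiff_curl_top (hΨs R)).continuous
  have hDΨc : ∀ R, Continuous (fderiv ℝ (Ψ R)) := fun R => (hΨs R).continuous_fderiv (by simp)
  have hδ1 : ∀ R x, ‖fderiv ℝ (Ψ R) x - fderiv ℝ V x‖ = ‖iteratedFDeriv ℝ 1 (fun y => Ψ R y - V y) x‖ := by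
    intro R x
    rw [norm_iteratedFDeriv_one, fderiv_fun_sub (((hΨ1 R).differentiable one_ne_zero) x)
      ((hV1.differentiable one_ne_zero) x)]
  have hδc : ∀ R x, ‖curl (Ψ R) x - curl V x‖ ≤ κ * ‖iteratedFDeriv ℝ 1 (fun y => Ψ R y - V y) x‖ := fun R x =>
    norm_curl_sub_le (hΨ1 R) hV1 x
  have he1 : Tendsto (fun R : ℝ => ∫⁻ x, ‖iteratedFDeriv ℝ 1 (fun x => Ψ R x - V x) x‖ₑ ^ 2) atTop (𝓝 0) := by
    rw [hΨdef]; exact tendsto_lintegral_iteratedFDeriv_one_sub hV hV6 hD1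
  have hd1m : ∀ R, Measurable fun x => ‖iteratedFDeriv ℝ 1 (fun y => Ψ R y - V y) x‖ₑ := fun R =>
    (((hΨ1 R).sub hV1).continuous_iteratedFDeriv le_rfl).enorm.measurable
  have hsq : ∀ y : EuclideanSpace ℝ (Fin 3), ‖y‖ₑ ^ 2 = ENNReal.ofReal (‖y‖ ^ 2) := fun y => by
    rw [← ofReal_norm, ENNReal.ofReal_pow (norm_nonneg _)]
  rw [← integral_const_mul]
  refine tendsto_integral_of_sq_dominated (C := ENNReal.ofReal (3 * κ * B)) (g := fun x => ‖curl V x‖ₑ)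
    (d := fun R x => ‖iteratedFDeriv ℝ 1 (fun y => Ψ R y - V y) x‖ₑ) ENNReal.ofReal_ne_top ?_ ?_
    hωc.measurable.enorm hZ hd1m ?_ he1
  · filter_upwards [eventually_gt_atTop 0] with R hR
    refine integrable_of_eq_zero_off_tsupport (hΨc R hR) ?_ fun x hx => ?_
    · exact (((hcΨc R).inner (hDVc.clm_apply hωc)).add (hωc.inner ((hDΨc R).clm_apply hωc))).add
        (hωc.inner (hDVc.clm_apply (hcΨc R)))
    · obtain ⟨hA, hb, -⟩ := fderiv_curl_eq_zero_of_notMem_tsupport hx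
      simp [hA, hb]
  · refine integrable_of_abs_le_of_lintegral (G := fun x => ENNReal.ofReal (3 * B) * ‖curl V x‖ₑ ^ 2)
      (continuous_const.mul (hωc.inner (hDVc.clm_apply hωc))).aestronglyMeasurable (fun x => ?_) ?_
    · rw [hsq, ← ENNReal.ofReal_mul (by positivity)]
      refine ENNReal.ofReal_le_ofReal ?_
      rw [abs_mul, abs_of_pos (by norm_num : (0 : ℝ) < 3)]
      have h := abs_real_inner_le_norm (curl V x) (fderiv ℝ V x (curl V x))
      have h' : ‖fderiv ℝ V x (curl V x)‖ ≤ B * ‖curl V x‖ :=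
        ((fderiv ℝ V x).le_opNorm _).trans (mul_le_mul_of_nonneg_right (hB x) (norm_nonneg _))
      nlinarith [norm_nonneg (curl V x)]
    · rw [lintegral_const_mul' _ _ ENNReal.ofReal_ne_top]
      exact ENNReal.mul_lt_top ENNReal.ofReal_lt_top hZ
  · refine Eventually.of_forall fun R x => ?_
    have hg : (‖curl V x‖ₑ : ℝ≥0∞) = ENNReal.ofReal ‖curl V x‖ := by exact (ofReal_norm (curl V x)).symm
    have hd : (‖iteratedFDeriv ℝ 1 (fun y => Ψ R y - V y) x‖ₑ : ℝ≥0∞) =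
        ENNReal.ofReal ‖iteratedFDeriv ℝ 1 (fun y => Ψ R y - V y) x‖ := by
      exact (ofReal_norm (iteratedFDeriv ℝ 1 (fun y => Ψ R y - V y) x)).symm
    rw [Real.enorm_eq_ofReal_abs, hg, hd, ← ENNReal.ofReal_mul (by positivity), ← ENNReal.ofReal_mul (by positivity)]
    refine ENNReal.ofReal_le_ofReal ?_
    set δ := ‖iteratedFDeriv ℝ 1 (fun y => Ψ R y - V y) x‖
    have e1 : |⟪curl (Ψ R) x, fderiv ℝ V x (curl V x)⟫ - ⟪curl V x, fderiv ℝ V x (curl V x)⟫| ≤ κ * δ * (B * ‖curl V x‖) := by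
      rw [← inner_sub_left]
      refine (abs_real_inner_le_norm _ _).trans (mul_le_mul (hδc R x) ?_ (norm_nonneg _) (by positivity))
      exact ((fderiv ℝ V x).le_opNorm _).trans (mul_le_mul_of_nonneg_right (hB x) (norm_nonneg _))
    have e2 : |⟪curl V x, fderiv ℝ (Ψ R) x (curl V x)⟫ - ⟪curl V x, fderiv ℝ V x (curl V x)⟫| ≤ ‖curl V x‖ * (δ * (κ * B)) := by
      rw [← inner_sub_right, show fderiv ℝ (Ψ R) x (curl V x) - fderiv ℝ V x (curl V x) =
        (fderiv ℝ (Ψ R) x - fderiv ℝ V x) (curl V x) from rfl]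
      refine (abs_real_inner_le_norm _ _).trans (mul_le_mul_of_nonneg_left ?_ (norm_nonneg _))
      refine ((fderiv ℝ (Ψ R) x - fderiv ℝ V x).le_opNorm _).trans ?_
      rw [hδ1 R x]
      exact mul_le_mul_of_nonneg_left (hωB x) (norm_nonneg _)
    have e3 : |⟪curl V x, fderiv ℝ V x (curl (Ψ R) x)⟫ - ⟪curl V x, fderiv ℝ V x (curl V x)⟫| ≤ ‖curl V x‖ * (B * (κ * δ)) := by
      rw [← inner_sub_right, ← (fderiv ℝ V x).map_sub]
      refine (abs_real_inner_le_norm _ _).trans (mul_le_mul_of_nonneg_left ?_ (norm_nonneg _))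
      exact ((fderiv ℝ V x).le_opNorm _).trans (mul_le_mul (hB x) (hδc R x) (norm_nonneg _) hB0)
    have hsplit : (⟪curl (Ψ R) x, fderiv ℝ V x (curl V x)⟫ + ⟪curl V x, fderiv ℝ (Ψ R) x (curl V x)⟫ +
        ⟪curl V x, fderiv ℝ V x (curl (Ψ R) x)⟫) - 3 * ⟪curl V x, fderiv ℝ V x (curl V x)⟫ =
        (⟪curl (Ψ R) x, fderiv ℝ V x (curl V x)⟫ - ⟪curl V x, fderiv ℝ V x (curl V x)⟫) +
        (⟪curl V x, fderiv ℝ (Ψ R) x (curl V x)⟫ - ⟪curl V x, fderiv ℝ V x (curl V x)⟫) +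
        (⟪curl V x, fderiv ℝ V x (curl (Ψ R) x)⟫ - ⟪curl V x, fderiv ℝ V x (curl V x)⟫) := by ring
    rw [hsplit]
    refine (abs_add_three _ _ _).trans ?_
    have e1' : κ * δ * (B * ‖curl V x‖) = κ * B * ‖curl V x‖ * δ := by ring
    have e2' : ‖curl V x‖ * (δ * (κ * B)) = κ * B * ‖curl V x‖ * δ := by ring
    have e3' : ‖curl V x‖ * (B * (κ * δ)) = κ * B * ‖curl V x‖ * δ := by ring
    rw [e1'] at e1
    rw [e2'] at e2
    rw [e3'] at e3
    linarith [e1, e2, e3]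

/-- **Enstrophy variation along the truncations**: `∫ ⟪ω, curl Ψ_R⟫ → ∫ ‖ω‖²`. [folklore] -/
theorem tendsto_truncation_enstrophyVariation (hV : ContDiff ℝ (⊤ : ℕ∞) V)
    (hV6 : ∫⁻ x, ‖V x‖ₑ ^ 6 < ⊤) (hD1 : ∫⁻ x, ‖iteratedFDeriv ℝ 1 V x‖ₑ ^ 2 < ⊤) :
    Tendsto (fun R : ℝ => ∫ x, ⟪curl V x, curl (solenoidalTruncation V R) x⟫) atTop (𝓝 (∫ x, ‖curl V x‖ ^ 2)) := by
  obtain ⟨Ψ, hΨdef⟩ : ∃ Ψ : ℝ → EuclideanSpace ℝ (Fin 3) → EuclideanSpace ℝ (Fin 3), Ψ = fun R => solenoidalTruncation V R :=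
    ⟨_, rfl⟩
  have hΨR : ∀ R, solenoidalTruncation V R = Ψ R := fun R => by rw [hΨdef]
  simp only [hΨR]
  set κ : ℝ := ‖curlCLM‖ with hκ
  have hκ0 : 0 ≤ κ := norm_nonneg curlCLM
  have hV1 : ContDiff ℝ 1 V := contDiff_infty.1 hV 1
  have hZ := lintegral_enorm_curl_sq_lt_top hD1
  have hωc : Continuous (curl V) := (contDiff_curl_top hV).continuous
  have hΨs : ∀ R, ContDiff ℝ ∞ (Ψ R) := by rw [hΨdef]; exact fun R => contDiff_solenoidalTruncation hV R
  have hΨ1 : ∀ R, ContDiff ℝ 1 (Ψ R) := fun R => contDiff_infty.1 (hΨs R) 1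
  have hΨc : ∀ R, 0 < R → HasCompactSupport (Ψ R) := by
    rw [hΨdef]; exact fun R hR => hasCompactSupport_solenoidalTruncation hR
  have hcΨc : ∀ R, Continuous (curl (Ψ R)) := fun R => (contDiff_curl_top (hΨs R)).continuous
  have hδc : ∀ R x, ‖curl (Ψ R) x - curl V x‖ ≤ κ * ‖iteratedFDeriv ℝ 1 (fun y => Ψ R y - V y) x‖ := fun R x =>
    norm_curl_sub_le (hΨ1 R) hV1 x
  have he1 : Tendsto (fun R : ℝ => ∫⁻ x, ‖iteratedFDeriv ℝ 1 (fun x => Ψ R x - V x) x‖ₑ ^ 2) atTop (𝓝 0) := by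
    rw [hΨdef]; exact tendsto_lintegral_iteratedFDeriv_one_sub hV hV6 hD1
  have hd1m : ∀ R, Measurable fun x => ‖iteratedFDeriv ℝ 1 (fun y => Ψ R y - V y) x‖ₑ := fun R =>
    (((hΨ1 R).sub hV1).continuous_iteratedFDeriv le_rfl).enorm.measurable
  have hsq : ∀ y : EuclideanSpace ℝ (Fin 3), ‖y‖ₑ ^ 2 = ENNReal.ofReal (‖y‖ ^ 2) := fun y => by
    rw [← ofReal_norm, ENNReal.ofReal_pow (norm_nonneg _)]
  have hlim : (∫ x, ‖curl V x‖ ^ 2) = ∫ x, ⟪curl V x, curl V x⟫ :=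
    integral_congr_ae (Eventually.of_forall fun x => (real_inner_self_eq_norm_sq _).symm)
  rw [hlim]
  refine tendsto_integral_of_sq_dominated (C := ENNReal.ofReal κ) (g := fun x => ‖curl V x‖ₑ)
    (d := fun R x => ‖iteratedFDeriv ℝ 1 (fun y => Ψ R y - V y) x‖ₑ) ENNReal.ofReal_ne_top ?_ ?_
    hωc.measurable.enorm hZ hd1m ?_ he1
  · filter_upwards [eventually_gt_atTop 0] with R hR
    refine integrable_of_eq_zero_off_tsupport (hΨc R hR) (hωc.inner (hcΨc R)) fun x hx => ?_
    obtain ⟨-, hb, -⟩ := fderiv_curl_eq_zero_of_notMem_tsupport hx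
    simp [hb]
  · refine integrable_of_abs_le_of_lintegral (G := fun x => ‖curl V x‖ₑ ^ 2)
      (hωc.inner hωc).aestronglyMeasurable (fun x => ?_) hZ
    rw [hsq, real_inner_self_eq_norm_sq, abs_of_nonneg (sq_nonneg _)]
  · refine Eventually.of_forall fun R x => ?_
    have hg : (‖curl V x‖ₑ : ℝ≥0∞) = ENNReal.ofReal ‖curl V x‖ := by exact (ofReal_norm (curl V x)).symm
    have hd : (‖iteratedFDeriv ℝ 1 (fun y => Ψ R y - V y) x‖ₑ : ℝ≥0∞) =
        ENNReal.ofReal ‖iteratedFDeriv ℝ 1 (fun y => Ψ R y - V y) x‖ := by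
      exact (ofReal_norm (iteratedFDeriv ℝ 1 (fun y => Ψ R y - V y) x)).symm
    rw [Real.enorm_eq_ofReal_abs, hg, hd, ← ENNReal.ofReal_mul hκ0, ← ENNReal.ofReal_mul (by positivity)]
    refine ENNReal.ofReal_le_ofReal ?_
    rw [← inner_sub_right]
    refine (abs_real_inner_le_norm _ _).trans ?_
    calc ‖curl V x‖ * ‖curl (Ψ R) x - curl V x‖ ≤ ‖curl V x‖ * (κ * ‖iteratedFDeriv ℝ 1 (fun y => Ψ R y - V y) x‖) :=
          mul_le_mul_of_nonneg_left (hδc R x) (norm_nonneg _)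
      _ = κ * ‖curl V x‖ * ‖iteratedFDeriv ℝ 1 (fun y => Ψ R y - V y) x‖ := by ring

/-- **Palinstrophy variation along the truncations**: `∫ ∑ᵢ ⟪Dω eᵢ, D(curl Ψ_R) eᵢ⟫ → ∫ |Dω|²_F`. [folklore] -/
theorem tendsto_truncation_palinstrophyVariation (hV : ContDiff ℝ (⊤ : ℕ∞) V)
    (hV6 : ∫⁻ x, ‖V x‖ₑ ^ 6 < ⊤) (hD1 : ∫⁻ x, ‖iteratedFDeriv ℝ 1 V x‖ₑ ^ 2 < ⊤)
    (hD2 : ∫⁻ x, ‖iteratedFDeriv ℝ 2 V x‖ₑ ^ 2 < ⊤) :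
    Tendsto (fun R : ℝ => ∫ x, ∑ i, ⟪fderiv ℝ (curl V) x (EuclideanSpace.basisFun (Fin 3) ℝ i),
        fderiv ℝ (curl (solenoidalTruncation V R)) x (EuclideanSpace.basisFun (Fin 3) ℝ i)⟫) atTop
      (𝓝 (∫ x, frobeniusNormSq (fderiv ℝ (curl V) x))) := by
  obtain ⟨Ψ, hΨdef⟩ : ∃ Ψ : ℝ → EuclideanSpace ℝ (Fin 3) → EuclideanSpace ℝ (Fin 3), Ψ = fun R => solenoidalTruncation V R :=
    ⟨_, rfl⟩
  have hΨR : ∀ R, solenoidalTruncation V R = Ψ R := fun R => by rw [hΨdef]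
  simp only [hΨR]
  set κ : ℝ := ‖curlCLM‖ with hκ
  have hκ0 : 0 ≤ κ := norm_nonneg curlCLM
  have hV2 : ContDiff ℝ 2 V := contDiff_infty.1 hV 2
  have hP := lintegral_ofReal_norm_fderiv_curl_sq_lt_top hV2 hD2
  have hDωc : Continuous (fderiv ℝ (curl V)) := (contDiff_curl_top hV).continuous_fderiv (by simp)
  have hΨs : ∀ R, ContDiff ℝ ∞ (Ψ R) := by rw [hΨdef]; exact fun R => contDiff_solenoidalTruncation hV R
  have hΨ2 : ∀ R, ContDiff ℝ 2 (Ψ R) := fun R => contDiff_infty.1 (hΨs R) 2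
  have hΨc : ∀ R, 0 < R → HasCompactSupport (Ψ R) := by
    rw [hΨdef]; exact fun R hR => hasCompactSupport_solenoidalTruncation hR
  have hDcΨc : ∀ R, Continuous (fderiv ℝ (curl (Ψ R))) := fun R =>
    (contDiff_curl_top (hΨs R)).continuous_fderiv (by simp)
  have hδ2 : ∀ R x, ‖fderiv ℝ (curl (Ψ R)) x - fderiv ℝ (curl V) x‖ ≤ κ * ‖iteratedFDeriv ℝ 2 (fun y => Ψ R y - V y) x‖ :=
    fun R x => norm_fderiv_curl_sub_le (hΨ2 R) hV2 x
  have he2 : Tendsto (fun R : ℝ => ∫⁻ x, ENNReal.ofReal ‖iteratedFDeriv ℝ 2 (fun y => Ψ R y - V y) x‖ ^ 2) atTop (𝓝 0) := by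
    have h : Tendsto (fun R : ℝ => ∫⁻ x, ‖iteratedFDeriv ℝ 2 (fun x => Ψ R x - V x) x‖ₑ ^ 2) atTop (𝓝 0) := by
      rw [hΨdef]; exact tendsto_lintegral_iteratedFDeriv_two_sub hV hV6 hD1 hD2
    refine h.congr fun R => lintegral_congr fun x => ?_
    exact congrArg (fun t : ℝ≥0∞ => t ^ 2) (ofReal_norm (iteratedFDeriv ℝ 2 (fun y => Ψ R y - V y) x)).symm
  have hd2m : ∀ R, Measurable fun x => ENNReal.ofReal ‖iteratedFDeriv ℝ 2 (fun y => Ψ R y - V y) x‖ := fun R =>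
    (((hΨ2 R).sub hV2).continuous_iteratedFDeriv le_rfl).norm.measurable.ennreal_ofReal
  have hlim : (∫ x, frobeniusNormSq (fderiv ℝ (curl V) x)) = ∫ x, ∑ i, ⟪fderiv ℝ (curl V) x (EuclideanSpace.basisFun (Fin 3) ℝ i),
      fderiv ℝ (curl V) x (EuclideanSpace.basisFun (Fin 3) ℝ i)⟫ :=
    integral_congr_ae (Eventually.of_forall fun x => (sum_inner_apply_basisFun_self _).symm)
  rw [hlim]
  refine tendsto_integral_of_sq_dominated (C := ENNReal.ofReal (3 * κ)) (g := fun x => ENNReal.ofReal ‖fderiv ℝ (curl V) x‖)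
    (d := fun R x => ENNReal.ofReal ‖iteratedFDeriv ℝ 2 (fun y => Ψ R y - V y) x‖) ENNReal.ofReal_ne_top ?_ ?_
    hDωc.norm.measurable.ennreal_ofReal hP hd2m ?_ he2
  · filter_upwards [eventually_gt_atTop 0] with R hR
    refine integrable_of_eq_zero_off_tsupport (hΨc R hR)
      (continuous_finsetSum _ fun i _ => (hDωc.clm_apply continuous_const).inner ((hDcΨc R).clm_apply continuous_const))
      fun x hx => ?_
    obtain ⟨-, -, hc⟩ := fderiv_curl_eq_zero_of_notMem_tsupport hx
    simp [hc]
  · refine integrable_of_abs_le_of_lintegral (G := fun x => ENNReal.ofReal 3 * ENNReal.ofReal ‖fderiv ℝ (curl V) x‖ ^ 2)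
      (continuous_finsetSum _ fun i _ => (hDωc.clm_apply continuous_const).inner (hDωc.clm_apply continuous_const)).aestronglyMeasurable
      (fun x => ?_) ?_
    · rw [← ENNReal.ofReal_pow (norm_nonneg _), ← ENNReal.ofReal_mul (by norm_num)]
      refine ENNReal.ofReal_le_ofReal ?_
      have h := abs_sum_inner_apply_basisFun_le (fderiv ℝ (curl V) x) (fderiv ℝ (curl V) x)
      nlinarith [h]
    · rw [lintegral_const_mul' _ _ ENNReal.ofReal_ne_top]
      exact ENNReal.mul_lt_top ENNReal.ofReal_lt_top hP
  · refine Eventually.of_forall fun R x => ?_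
    have k1 := abs_sum_inner_apply_basisFun_sub_le (fderiv ℝ (curl V) x) (fderiv ℝ (curl (Ψ R)) x) (fderiv ℝ (curl V) x)
    have k2 : 3 * ‖fderiv ℝ (curl V) x‖ * ‖fderiv ℝ (curl (Ψ R)) x - fderiv ℝ (curl V) x‖ ≤
        3 * ‖fderiv ℝ (curl V) x‖ * (κ * ‖iteratedFDeriv ℝ 2 (fun y => Ψ R y - V y) x‖) :=
      mul_le_mul_of_nonneg_left (hδ2 R x) (mul_nonneg (by norm_num) (norm_nonneg _))
    have k3 : 3 * ‖fderiv ℝ (curl V) x‖ * (κ * ‖iteratedFDeriv ℝ 2 (fun y => Ψ R y - V y) x‖) =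
        3 * κ * ‖fderiv ℝ (curl V) x‖ * ‖iteratedFDeriv ℝ 2 (fun y => Ψ R y - V y) x‖ := by ring
    have key := (k1.trans k2).trans k3.le
    have h3κ : (0 : ℝ) ≤ 3 * κ := by positivity
    have h3κn : (0 : ℝ) ≤ 3 * κ * ‖fderiv ℝ (curl V) x‖ := mul_nonneg h3κ (norm_nonneg _)
    rw [Real.enorm_eq_ofReal_abs, ← ENNReal.ofReal_mul h3κ, ← ENNReal.ofReal_mul h3κn]
    exact ENNReal.ofReal_le_ofReal key

end ExtremiserLiouville

end Summit.NavierStokesRegularity.NavierStokesRegularity.Theorems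

end
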